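import Mathlib
import Summits.NavierStokesRegularity.NavierStokesRegularity.Theorems.TaoLadderRungTwoFlatCaptureBlock
import HarnessLib

/-!
# THE K4 CAPTURE-TYPE BOUND FROM THE BLOCK WITH THE DECAYING CUT ENVELOPE AHEAD (repair of the ahead half of `capB_of_block`)
  (helper for the K_A♭ parent item stmt-NavierStokesRegularity-22987 `FlatGapCertificatesV2`, route TaoLadderRungTwoFlat; cell
  harvest/h2-tao-ladder, p1 g25)

`HopTube.capB_of_block` (…CaptureBlock) asks `ω_k D_k ≤ D^Ω` for ALL `k` together with `D_k ≥ 2G` beyond the block — jointly infeasible for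
an admissible (unbounded ahead) Banach weight `ω`. The honest ahead half uses the DECAYING cut schedule, as `apriori_tube_uniform` does:
* `capB_of_block_cuts` — the K4 input `hcapB` at a hop `n ≤ N₀`: a uniform `ω`-bound of the kick-ball states of `H(n)` and of all their
  short flows, from the conditional block row along the short flows (`devProfile_of_conditionalBlock_ball`: block and below), and BEYOND
  the block from the cut family of `aheadCuts_of_schedule` run at the short horizon (its window-top hull now unconditional), with the row
  `ω_k·2G_{k−1} ≤ B_G`; weight rows `ω ≤ Ω_w w`, `ω ≤ Ω_K` below `k₁`, `ω_k|Z_k| ≤ M_Z^ω`, `ω_k D_k ≤ D^Ω` on `k ≤ k_B` only.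

HONEST FRAMING: composition over the cell's typed frame (MODEL lattice); the conditional block row and every row are BOOKED HYPOTHESES;
nothing certified; no item closed; nothing about the Navier–Stokes equations.
-/

noncomputable section

-- the sub-problem namespace repeats the summit name by design (D-0017)
set_option linter.dupNamespace false

namespace Summit.NavierStokesRegularity.NavierStokesRegularity.Theorems.HopTube

open Set Finset Filter Topology Literature.Analysis.FluidPDE Literature.Analysis.FluidPDE.TaoCascade MirrorPulse RenormFrame QuadPolar

section Block

variable {ε ε₀ : ℝ}

set_option maxHeartbeats 800000 in
/-- **THE K4 CAPTURE-TYPE BOUND AT A HOP `n ≤ N₀` FROM THE BLOCK, AHEAD HALF BY THE CUT SCHEDULE.** See the module docstring.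
[cite: Tao2016AveragedNS, §4 Lemma 4.1 (4.5), §6.2 Prop. 6.3 (ix) (statement shape); cell LADDER §47.5 L2 (K4), §62, §70 (A70-3)] -/
theorem capB_of_block_cuts (P : TubeSchedule) {Bcl : ℕ → (Fin 2 → ℤ → ℝ) → Prop} {i₀ : Fin 2}
    {X₀ : Fin 2 → ℝ} {w ω : ℤ → ℝ} {r c₀ : ℝ} {ζ : ℕ → Fin 2 → ℤ → ℝ} {ustar : Fin 2 → ℤ → ℝ} {n : ℕ}
    (hε : 0 ≤ ε) (hε₀ : 0 < ε₀) (hn : n ≤ P.N₀)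
    (hζ0 : ζ 0 = datumState i₀ X₀) (hη0 : 0 ≤ P.η 0) (hk₁ : 1 ≤ P.k₁) (hr0 : 0 ≤ r) (hw1 : ∀ k, 1 ≤ w k)
    {kL kB : ℤ} {Z : Fin 2 → ℤ → ℝ → ℝ} {Dk G Ω : ℤ → ℝ} {ℓb BL Vtop : ℝ}
    (hLB : kL ≤ kB) (hk₁B : (P.k₁ : ℤ) ≤ kB + 1) (hGpos : 0 < G kB) (hG0 : ∀ j, kB ≤ j → 0 ≤ G j) (hℓb : 0 < ℓb) (hBL : 0 ≤ BL)
    (hVtop : 0 ≤ Vtop)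
    (hblock : ∀ z S₀ s S F, InTubeWith P Bcl i₀ X₀ w r ζ ustar n z → (∀ i k, w k * |S₀ i k - z i k| ≤ r) → 0 < s →
      PseudoFlowOnShift shiftSetFlat s ε₀ (mirrorTable ε ε) 0 0 S₀ (fun i k => (1 / 2) * S₀ i k ^ 2) (fun _ _ => 0) S F →
        ∀ t ∈ Icc 0 c₀, t ≤ s →
          (∀ s' ∈ Icc 0 t, ∀ i : Fin 2, |S i (kB + 1) s'| ≤ 4 * G kB ∧ ∀ k : ℤ, k < kL → |S i k s'| ≤ 2 * ℓb) →
            ∀ s' ∈ Icc 0 t, ∀ (i : Fin 2) (k : ℤ), kL ≤ k → k ≤ kB → |S i k s' - Z i k s'| ≤ Dk k)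
    (hζb : ∀ (i : Fin 2) (k : ℤ), k < kL → ζ n i k = 0)
    (hVt : ∀ s ∈ Icc 0 c₀, |Z 1 kB s| + Dk kB ≤ Vtop)
    (hΩ : ∀ j, kB ≤ j → ∀ N : Finset ℤ, (∀ m ∈ N, j < m) → ∑ m ∈ N, (w m)⁻¹ ^ 2 ≤ Ω j)
    (hGΩ : ∀ j, kB ≤ j → 2 * (9 / 8 * r) ^ 2 * Ω j ≤ G j ^ 2)
    (hcloseA : 4 / 3 * c₀ * clock ε₀ kB * Vtop * (Vtop + 2 * ε * G kB) < G kB)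
    (hcloseG : ∀ j, kB ≤ j → 4 / 3 * c₀ * clock ε₀ (j + 1) * (2 * G j) * (2 * G j + 2 * ε * G (j + 1)) < G (j + 1))
    (hBLrow : ∀ s ∈ Icc 0 c₀, ∀ i : Fin 2, |Z i kL s| + Dk kL ≤ BL)
    (hcloseB : P.η n + r + c₀ * clockW ε₀ (kL - 1) * tableAbsSum shiftSetFlat (mirrorTable ε ε) * max (2 * ℓb) BL ^ 2 ≤ ℓb)
    (hZb : ∀ (i : Fin 2) (k : ℤ) (s : ℝ), k < kL → Z i k s = 0) (hZa : ∀ (i : Fin 2) (k : ℤ) (s : ℝ), kB < k → Z i k s = 0)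
    (hDb : ∀ k : ℤ, k < kL → ℓb ≤ Dk k) (hDa : ∀ k : ℤ, kB < k → 2 * G kB ≤ Dk k)
    -- weight rows
    {Ωw ΩK Mζ MZω DΩ BG : ℝ} (hω0 : ∀ k, 0 ≤ ω k) (hΩw : 0 ≤ Ωw) (hωw : ∀ k, ω k ≤ Ωw * w k) (hΩK : 0 ≤ ΩK)
    (hωK : ∀ k, k < (P.k₁ : ℤ) → ω k ≤ ΩK) (hMζ : ∀ (i : Fin 2) (k : ℤ), k < (P.k₁ : ℤ) → |ζ n i k| ≤ Mζ)
    (hZω : ∀ i k, ∀ t ∈ Icc 0 c₀, ω k * |Z i k t| ≤ MZω) (hωD : ∀ k, k ≤ kB → ω k * Dk k ≤ DΩ)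
    (hGω : ∀ k : ℤ, kB < k → ω k * (2 * G (k - 1)) ≤ BG) :
    ∃ Bn : ℝ, ∀ z S₀ : Fin 2 → ℤ → ℝ, InTubeWith P Bcl i₀ X₀ w r ζ ustar n z → (∀ i k, w k * |S₀ i k - z i k| ≤ r) →
      (∀ (i : Fin 2) (k : ℤ), ω k * |S₀ i k| ≤ Bn) ∧
        ∀ s : ℝ, 0 < s → s ≤ c₀ → ∀ S F : Fin 2 → ℤ → ℝ → ℝ,
          PseudoFlowOnShift shiftSetFlat s ε₀ (mirrorTable ε ε) 0 0 S₀ (fun i k => (1 / 2) * S₀ i k ^ 2) (fun _ _ => 0) S F →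
            ∀ t ∈ Icc 0 s, ∀ (i : Fin 2) (k : ℤ), ω k * |S i k t| ≤ Bn := by
  have hw0 : ∀ k, 0 < w k := fun k => lt_of_lt_of_le one_pos (hw1 k)
  have hε₀' : (-1 : ℝ) ≤ ε₀ := by linarith
  have hι : ∀ z S₀ : Fin 2 → ℤ → ℝ, InTubeWith P Bcl i₀ X₀ w r ζ ustar n z → (∀ i k, w k * |S₀ i k - z i k| ≤ r) →
      ∀ (i : Fin 2) (k : ℤ), k < kL → |S₀ i k| ≤ P.η n + r := fun z S₀ hz hkick =>
    init_below_of_captureClause P (capture_of_inTubeWith_le P hn hζ0 hη0 hk₁ hr0 hz).1 hζb hw1 hkick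
  have hinitj : ∀ j, kB ≤ j → ∀ z S₀ : Fin 2 → ℤ → ℝ, InTubeWith P Bcl i₀ X₀ w r ζ ustar n z →
      (∀ i k, w k * |S₀ i k - z i k| ≤ r) → ∀ N : Finset ℤ, (∀ m ∈ N, j < m) → ∑ m ∈ N, ∑ i : Fin 2, S₀ i m ^ 2 ≤ G j ^ 2 :=
    fun j hj z S₀ hz hkick N hN =>
      (initialTail_le_of_clauses P hw0 hr0 (capture_of_inTubeWith_le P hn hζ0 hη0 hk₁ hr0 hz).2 hkick
        (j := j) (by omega) hN (hΩ j hj N hN)).trans (hGΩ j hj)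
  have hdev := devProfile_of_conditionalBlock_ball P hε hε₀ hLB hGpos hℓb hVtop hBL hblock hVt (hinitj kB le_rfl) hcloseA hι
    hBLrow hcloseB hZb hZa hDb hDa
  -- the cut family along the premises at every short horizon `s ≤ c₀`
  have hcuts : ∀ s : ℝ, 0 < s → s ≤ c₀ → ∀ k, kB - 1 < k →
      AheadCutBoundWith P Bcl shiftSetFlat ε₀ i₀ (mirrorTable ε ε) X₀ w r s ζ ustar n k (G k) := by
    intro s hs hsc
    have hmono : ∀ {X : ℝ}, 0 ≤ X → 4 / 3 * s * X ≤ 4 / 3 * c₀ * X := fun hX => by nlinarith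
    refine aheadCuts_of_schedule (kA := kB - 1) hε hε₀ hs.le hVtop (fun j hj => hG0 j (by omega)) ?_ ?_ ?_ ?_
    · -- the window-top hull at `k_B`, unconditional along every premise at horizon `s`
      intro z' S₀' τ' S' F' hprem' t ht
      obtain ⟨hz', hkick', hsτ, hflow'⟩ := hprem'
      have hS' := GappedFrontRobustOn.pseudoFlowOnShift_mono hflow' hs hsτ
      have hd := hdev z' S₀' s S' F' hz' hkick' hs hsc hS' t ht 1 kB
      have hz1 := hVt t ⟨ht.1, ht.2.trans hsc⟩
      have h3 := abs_sub_abs_le_abs_sub (S' 1 kB t) (Z 1 kB t)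
      rw [show kB - 1 + 1 = kB by ring]
      linarith only [hd, hz1, h3]
    · intro j hj z' S₀' τ' S' F' hprem' N hN
      exact hinitj j (by omega) z' S₀' hprem'.1 hprem'.2.1 N hN
    · rw [show kB - 1 + 1 = kB by ring]
      have hX : 0 ≤ clock ε₀ kB * Vtop * (Vtop + 2 * ε * G kB) := by
        have := hG0 kB le_rfl; have := clock_nonneg hε₀' kB; positivity
      calc 4 / 3 * s * clock ε₀ kB * Vtop * (Vtop + 2 * ε * G kB) = 4 / 3 * s * (clock ε₀ kB * Vtop * (Vtop + 2 * ε * G kB)) := by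
            ring
        _ ≤ 4 / 3 * c₀ * (clock ε₀ kB * Vtop * (Vtop + 2 * ε * G kB)) := hmono hX
        _ = 4 / 3 * c₀ * clock ε₀ kB * Vtop * (Vtop + 2 * ε * G kB) := by ring
        _ < G kB := hcloseA
    · intro j hj
      have hGj := hG0 j (by omega); have hGj1 := hG0 (j + 1) (by omega); have := clock_nonneg hε₀' (j + 1)
      have hX : 0 ≤ clock ε₀ (j + 1) * (2 * G j) * (2 * G j + 2 * ε * G (j + 1)) := by positivity
      calc 4 / 3 * s * clock ε₀ (j + 1) * (2 * G j) * (2 * G j + 2 * ε * G (j + 1))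
          = 4 / 3 * s * (clock ε₀ (j + 1) * (2 * G j) * (2 * G j + 2 * ε * G (j + 1))) := by ring
        _ ≤ 4 / 3 * c₀ * (clock ε₀ (j + 1) * (2 * G j) * (2 * G j + 2 * ε * G (j + 1))) := hmono hX
        _ = 4 / 3 * c₀ * clock ε₀ (j + 1) * (2 * G j) * (2 * G j + 2 * ε * G (j + 1)) := by ring
        _ < G (j + 1) := hcloseG j (by omega)
  -- the state bound and the flow bound
  set Bst : ℝ := max (Ωw * (9 / 8 * r)) (ΩK * (Mζ + P.η n + r)) with hBst
  refine ⟨max Bst (max (MZω + DΩ) BG), fun z S₀ hz hkick => ⟨fun i k => ?_, fun s hs hsc S F hS t ht i k => ?_⟩⟩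
  · obtain ⟨hcap, hA⟩ := capture_of_inTubeWith_le P hn hζ0 hη0 hk₁ hr0 hz
    have hwk := hw0 k
    have hkk : |S₀ i k - z i k| ≤ r / w k := by rw [le_div_iff₀ hwk, mul_comm]; exact hkick i k
    have htri : |S₀ i k| ≤ |S₀ i k - z i k| + |z i k| := by
      have := abs_add_le (S₀ i k - z i k) (z i k); rwa [sub_add_cancel] at this
    refine le_trans ?_ (le_max_left _ _)
    rcases lt_or_ge k (P.k₁ : ℤ) with hk | hk
    · have hz1 : |z i k| ≤ Mζ + P.η n := by
        have h1 := hcap i k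
        have := abs_sub_abs_le_abs_sub (z i k) (ζ n i k)
        linarith [hMζ i k hk]
      have hr1 : r / w k ≤ r := div_le_self hr0 (hw1 k)
      calc ω k * |S₀ i k| ≤ ΩK * (Mζ + P.η n + r) :=
            mul_le_mul (hωK k hk) (by linarith) (abs_nonneg _) hΩK
        _ ≤ Bst := le_max_right _ _
    · have hz1 : |z i k| ≤ r / (8 * w k) := by
        rw [le_div_iff₀ (by positivity)]; have := hA i k hk; linarith
      have hS : |S₀ i k| ≤ 9 / 8 * r / w k := by
        have e : r / w k + r / (8 * w k) = 9 / 8 * r / w k := by field_simp; ring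
        linarith
      calc ω k * |S₀ i k| ≤ Ωw * w k * (9 / 8 * r / w k) := mul_le_mul (hωw k) hS (abs_nonneg _) (by positivity)
        _ = Ωw * (9 / 8 * r) := by field_simp
        _ ≤ Bst := le_max_left _ _
  · refine le_trans ?_ (le_max_right _ _)
    rcases le_or_gt k kB with hk | hk
    · have hd := hdev z S₀ s S F hz hkick hs hsc hS t ht i k
      have hZ := hZω i k t ⟨ht.1, ht.2.trans hsc⟩
      have htri := abs_sub_abs_le_abs_sub (S i k t) (Z i k t)
      have h1 : ω k * |S i k t| ≤ ω k * |Z i k t| + ω k * Dk k := by nlinarith [hω0 k]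
      linarith [hωD k hk, le_max_left (MZω + DΩ) BG]
    · -- beyond the block: the decaying cut at `k − 1`
      have hcut := hcuts s hs hsc (k - 1) (by omega) z S₀ s S F ⟨hz, hkick, le_rfl, hS⟩ t ht i k (by omega)
      have h1 : ω k * |S i k t| ≤ ω k * (2 * G (k - 1)) := mul_le_mul_of_nonneg_left hcut (hω0 k)
      linarith [hGω k hk, le_max_right (MZω + DΩ) BG]

end Block

end Summit.NavierStokesRegularity.NavierStokesRegularity.Theorems.HopTube

end
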